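import Summits.AtomisticToContinuum.FouriersLaw.Theorems.BondHeatUncertaintyBoundedResponseBathHeatDCBandB
import HarnessLib

/-!
# BondHeatUncertainty / BoundedResponse — «DCBand» §6–§7 (main): ★ `(TV) ⟹ (FC)` — the band door's free input `SpectralDeficitNonneg` is the
`ω`-twist (TV) `TwistedHeatVarNonneg` (`V_N(ω,t) = 2γT²t − 2γ²∫₀ᵗ(t − r)cos(ωr)K_N ≥ 0`) of the TREE theorem `bathHeatVar_nonneg` (NODE 107) — (TV) at `ω = 0` is
that theorem (`twistedHeatVarNonneg_zero`) — via the affine Fejér limit `integral_Ioi_le_of_lagIntegral_le` (dominated convergence); and the weakest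
ONE-SIDED time-domain supplier (BNM) `BandNegMass` (`(γ/T²)∫min((r/cN²)²/2,2)K_N⁻ = O(1/N)`) of the band floor (`bandDeficitFloor_of_bandNegMass`,
`θ ≤ 1`), itself implied by NODE 109's `LateNegMass a` for every slope `a > 0` (`bandNegMass_of_lateNegMass`) — so every kernel / cumulant floor of
NODEs 107–110 feeds the band door, with quadratic (not linear) blindness to early lags
(decomp-a2c lens-1 g117, NODE 117 «DCBand»; part 3 of 3; imports part B `…BathHeatDCBandB` (doors, ladder) which imports part A `…BathHeatDCBandA`
(object, identity, pieces, engine, OVERVIEW docstring of the whole node))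

No `sorry`, no new axioms; `TwistedHeatVarNonneg` and `BandNegMass` are docstring-tagged ROUTE STATEMENTS of this cell (MustFail117).
-/

noncomputable section

open MeasureTheory ProbabilityTheory Filter Topology Set Function
open scoped NNReal ENNReal
open Literature.MathematicalPhysics.KineticTheory.HeatConduction
open Literature.MathematicalPhysics.KineticTheory OscillatorChain
open Literature.Probability.Process
open Summit.AtomisticToContinuum.FouriersLaw.Theorems.SubdiffusiveBondHeat
open Summit.AtomisticToContinuum.FouriersLaw.Theorems.SubdiffusiveBondHeat.EscapeGrading
open Summit.AtomisticToContinuum.FouriersLaw.Theorems.OddSectorIrreversibility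

namespace Summit.AtomisticToContinuum.FouriersLaw.Theorems.BoundedResponse.HeatSpreading

open Summit.AtomisticToContinuum.FouriersLaw.Theorems.BoundedResponse.TransientContact
open Summit.AtomisticToContinuum.FouriersLaw.Theorems.BoundedResponse.TransientBand
open Summit.AtomisticToContinuum.FouriersLaw.Theses.BondHeatUncertainty (BoundedResponse SubdiffusiveBondHeat)
open Summit.AtomisticToContinuum.FouriersLaw.Theses.GriffithsLimitExchange (BoundaryDEP)

/-! ## §6 What (FC) asks of the tree: the `ω`-twist of the bath heat variance positivity -/

/-- **The `ω`-twisted bath heat variance** `V_N(ω,t) := 2γT²t − 2γ²∫₀ᵗ(t − r)cos(ωr)K_N(r)dr` — formally `E|∫₀ᵗ e^{iωs} dQ^{bath}_s|²` for the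
Kundu–Dhar–Narayan heat proxy of NODE 107 (whose `ω = 0` identity is the tree's `pinnedChain_bathHeat_sq_eq`; `V_N(0,t) = bathHeatVar_N(t)`,
`twistedHeatVar_zero`). [formal bookkeeping; this cell] -/
def twistedHeatVar (ω₂ lam β γ T : ℝ) (N : ℕ) (ω t : ℝ) : ℝ :=
  2 * γ * T ^ 2 * t - 2 * γ ^ 2 * ∫ r in (0 : ℝ)..t, (t - r) * (Real.cos (ω * r) * bathKinCorr ω₂ lam β γ T N r)

/-- `V_N(0,t) = bathHeatVar_N(t)`. [formal bookkeeping] -/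
theorem twistedHeatVar_zero (ω₂ lam β γ T : ℝ) (N : ℕ) (t : ℝ) :
    twistedHeatVar ω₂ lam β γ T N 0 t = bathHeatVar ω₂ lam β γ T N t := by
  simp only [twistedHeatVar, bathHeatVar, zero_mul, Real.cos_zero, one_mul]

/-- **(TV) `TwistedHeatVarNonneg`** — `V_N(ω,t) ≥ 0` for all parameters, `T > 0`, `N ≥ 2`, `t ≥ 0` and every `ω`: THE VERBATIM `ω`-TWIST of the tree
theorem `bathHeatVar_nonneg` (= its `ω = 0` instance, `twistedHeatVarNonneg_zero`).  Path-space content: `V_N(ω,t) = E|∫₀ᵗ cos(ωs)dQ_s|² + E|∫₀ᵗ sin(ωs)dQ_s|²`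
for the bath heat proxy `dQ_s = γ(T − p₀²)ds + d(martingale)`, the stochastic integrals of the deterministic `C¹` weights being DEFINED pathwise by parts;
expanding the squares needs the weighted two-time machinery of `…SubdiffusiveBondHeatSpectralPositivity` (`pinnedChain_integral_weightedTimeIntegral_mul_of_invariant`,
there for the `ds`-part alone) extended to the proxy's boundary term exactly as `pinnedChain_heatProxy_sq_eq` treats it at `ω = 0` (the cross-covariance
density `E[φ(z_s)dM_{s'}] = −2γ²K_N(s − s')ds'` is what turns `+2γ²∫∫cos·K` into `−2γ²∫∫cos·K`).  THEOREM-GRADE · ATTACKABLE · not yet in the tree;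
`(TV) ⟹ (FC)` is `spectralDeficitNonneg_of_twistedHeatVarNonneg` below (affine Fejér limit).  Why it might fail: it cannot; formalization cost only
(est. 500–800 lines, POINTERS-g118 §1). (piece · the free input in path-space form) [classical; this cell] -/
def TwistedHeatVarNonneg : Prop :=
  ∀ ω₂ lam β γ : ℝ, 0 < ω₂ → 0 < lam → 0 < β → 0 < γ → ∀ T : ℝ, 0 < T → ∀ N : ℕ, 2 ≤ N → ∀ ω t : ℝ, 0 ≤ t →
    0 ≤ twistedHeatVar ω₂ lam β γ T N ω t

/-- The `ω = 0` instance of (TV) is the tree theorem `bathHeatVar_nonneg` (NODE 107, Kundu–Dhar–Narayan variance `≥ 0`). [tree] -/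
theorem twistedHeatVarNonneg_zero :
    ∀ ω₂ lam β γ : ℝ, 0 < ω₂ → 0 < lam → 0 < β → 0 < γ → ∀ T : ℝ, 0 < T → ∀ N : ℕ, 2 ≤ N → ∀ t : ℝ, 0 ≤ t →
      0 ≤ twistedHeatVar ω₂ lam β γ T N 0 t := by
  intro ω₂ lam β γ hω hl hβ hγ T hT N hN t ht
  rw [twistedHeatVar_zero]
  exact bathHeatVar_nonneg hω hl hβ hγ (lt_of_lt_of_le one_lt_two hN) hT ht

/-- **Affine Fejér limit**: `g ∈ L¹(0,∞)` measurable and `∫₀ᵗ(t − r)g(r)dr ≤ A·t` for all `t ≥ 0` ⟹ `∫_{(0,∞)} g ≤ A` (the Cesàro means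
`∫(1 − r/t)⁺g → ∫g` by dominated convergence; the affine companion of the tree's `integral_Ioi_nonneg_of_lagIntegral_nonneg`). [folklore] -/
theorem integral_Ioi_le_of_lagIntegral_le {g : ℝ → ℝ} (hgm : Measurable g) (hgi : IntegrableOn g (Ioi 0)) {A : ℝ}
    (h : ∀ t : ℝ, 0 ≤ t → ∫ r in (0 : ℝ)..t, (t - r) * g r ≤ A * t) : ∫ u in Ioi (0 : ℝ), g u ≤ A := by
  have hwm : ∀ t : ℝ, Measurable fun r : ℝ => max (t - r) 0 := fun t => (measurable_const.sub measurable_id).max measurable_const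
  -- the Cesàro means, written over `(0,∞)` against the weight `max (t − r) 0 / t`, are `≤ A`
  have hF : ∀ t : ℝ, 0 < t → ∫ r in Ioi (0 : ℝ), max (t - r) 0 / t * g r ≤ A := by
    intro t ht
    have hint : IntegrableOn (fun r : ℝ => max (t - r) 0 * g r) (Ioi 0) := by
      refine Integrable.bdd_mul hgi (hwm t).aestronglyMeasurable (c := t) ?_
      refine (ae_restrict_mem measurableSet_Ioi).mono fun r hr => ?_
      rw [Real.norm_eq_abs, abs_of_nonneg (le_max_right _ _)]
      exact max_le (by linarith [show (0 : ℝ) < r from hr]) ht.le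
    have hIoc : ∫ r in Ioc 0 t, max (t - r) 0 * g r = ∫ r in (0 : ℝ)..t, (t - r) * g r := by
      rw [intervalIntegral.integral_of_le ht.le]
      refine setIntegral_congr_fun measurableSet_Ioc fun r hr => ?_
      rw [max_eq_left (by linarith [hr.2])]
    have hIoi : ∫ r in Ioi t, max (t - r) 0 * g r = 0 :=
      setIntegral_eq_zero_of_forall_eq_zero fun r hr => by
        rw [max_eq_right (by linarith [show t < r from hr]), zero_mul]
    have hsplit : ∫ r in Ioi (0 : ℝ), max (t - r) 0 * g r = ∫ r in (0 : ℝ)..t, (t - r) * g r := by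
      rw [← Ioc_union_Ioi_eq_Ioi ht.le, setIntegral_union Ioc_disjoint_Ioi_same measurableSet_Ioi
        (hint.mono_set Ioc_subset_Ioi_self) (hint.mono_set (Ioi_subset_Ioi ht.le)), hIoc, hIoi, add_zero]
    have hdiv : ∫ r in Ioi (0 : ℝ), max (t - r) 0 / t * g r = t⁻¹ * ∫ r in Ioi (0 : ℝ), max (t - r) 0 * g r := by
      rw [← integral_const_mul]
      refine integral_congr_ae (ae_of_all _ fun r => ?_)
      simp only
      ring
    rw [hdiv, hsplit]
    calc t⁻¹ * ∫ r in (0 : ℝ)..t, (t - r) * g r ≤ t⁻¹ * (A * t) := mul_le_mul_of_nonneg_left (h t ht.le) (inv_nonneg.2 ht.le)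
      _ = A := by field_simp
  -- dominated convergence: the means tend to `∫ g`
  have hlim : Tendsto (fun t : ℝ => ∫ r in Ioi (0 : ℝ), max (t - r) 0 / t * g r) atTop (𝓝 (∫ r in Ioi (0 : ℝ), g r)) := by
    refine tendsto_integral_filter_of_dominated_convergence (fun r => ‖g r‖) ?_ ?_ hgi.norm ?_
    · exact Eventually.of_forall fun t => (((hwm t).div_const t).mul hgm).aestronglyMeasurable
    · filter_upwards [eventually_gt_atTop (0 : ℝ)] with t ht
      refine (ae_restrict_mem measurableSet_Ioi).mono fun r hr => ?_
      rw [norm_mul]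
      refine mul_le_of_le_one_left (norm_nonneg _) ?_
      rw [Real.norm_eq_abs, abs_of_nonneg (div_nonneg (le_max_right _ _) ht.le), div_le_one ht]
      exact max_le (by linarith [show (0 : ℝ) < r from hr]) ht.le
    · refine (ae_restrict_mem measurableSet_Ioi).mono fun r _ => ?_
      have h1 : Tendsto (fun t : ℝ => 1 - r / t) atTop (𝓝 (1 - 0)) :=
        tendsto_const_nhds.sub (tendsto_const_nhds.div_atTop tendsto_id)
      rw [sub_zero] at h1
      have h2 : Tendsto (fun t : ℝ => max (t - r) 0 / t) atTop (𝓝 1) := by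
        refine h1.congr' ?_
        filter_upwards [eventually_ge_atTop (max r 1)] with t ht
        have htr : r ≤ t := le_trans (le_max_left _ _) ht
        have ht0 : (0 : ℝ) < t := lt_of_lt_of_le one_pos (le_trans (le_max_right _ _) ht)
        rw [max_eq_left (by linarith), sub_div, div_self ht0.ne']
      simpa using h2.mul_const (g r)
  exact le_of_tendsto hlim (by filter_upwards [eventually_gt_atTop (0 : ℝ)] with t ht using hF t ht)

/-- ★ **(TV) ⟹ (FC)**: the band door's free input is exactly the `ω`-twist of NODE 107's variance positivity — `0 ≤ V_N(ω,t)` for all `t` says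
`∫₀ᵗ(t − r)cos(ωr)K_N ≤ (T²/γ)t`, and the affine Fejér limit gives `∫_{(0,∞)}cos(ωr)K_N ≤ T²/γ`, i.e. `h_N(ω) ≥ 0`. [this cell] -/
theorem spectralDeficitNonneg_of_twistedHeatVarNonneg (hTV : TwistedHeatVarNonneg) : SpectralDeficitNonneg := by
  intro ω₂ lam β γ hω hl hβ hγ T hT N hN ω
  have hKc := continuous_escapeKernel hω hl hβ hγ hT N
  have hKi := integrableOn_escapeKernel hω hl hβ hγ hT N
  have hgm : Measurable fun r : ℝ => Real.cos (ω * r) * escapeKernel ω₂ lam β γ T N r :=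
    (Real.continuous_cos.measurable.comp (measurable_const.mul measurable_id)).mul hKc.measurable
  have hgi := integrableOn_cos_mul_kernel hKi ω
  have hA : ∀ t : ℝ, 0 ≤ t →
      ∫ r in (0 : ℝ)..t, (t - r) * (Real.cos (ω * r) * escapeKernel ω₂ lam β γ T N r) ≤ T ^ 2 / γ * t := by
    intro t ht
    have h := hTV ω₂ lam β γ hω hl hβ hγ T hT N hN ω t ht
    simp only [twistedHeatVar, bathKinCorr_eq_escapeKernel] at h
    rw [div_mul_eq_mul_div, le_div_iff₀ hγ]
    have h' : γ * ((∫ r in (0 : ℝ)..t, (t - r) * (Real.cos (ω * r) * escapeKernel ω₂ lam β γ T N r)) * γ) ≤ γ * (T ^ 2 * t) := by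
      nlinarith [h]
    exact le_of_mul_le_mul_left h' hγ
  have hle := integral_Ioi_le_of_lagIntegral_le hgm hgi hA
  rw [spectralDeficit, bathKinCorr_eq_escapeKernel]
  have h1 : γ / T ^ 2 * ∫ u in Ioi (0 : ℝ), Real.cos (ω * u) * escapeKernel ω₂ lam β γ T N u ≤ 1 :=
    calc γ / T ^ 2 * ∫ u in Ioi (0 : ℝ), Real.cos (ω * u) * escapeKernel ω₂ lam β γ T N u ≤ γ / T ^ 2 * (T ^ 2 / γ) :=
          mul_le_mul_of_nonneg_left hle (by positivity)
      _ = 1 := by field_simp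
  linarith

/-- **Beneath (S), in path-space form: (S) ∧ (TV) ∧ (BDF_θ) ⟹ 11071** (`θ > 0`). [this cell] -/
theorem boundedResponse_of_subdiffusiveBondHeat_twisted_bandDeficitFloor {θ : ℝ} (hθ : 0 < θ) (hS : SubdiffusiveBondHeat)
    (hTV : TwistedHeatVarNonneg) (hB : BandDeficitFloor θ) : BoundedResponse :=
  boundedResponse_of_subdiffusiveBondHeat_bandDeficitFloor hθ hS (spectralDeficitNonneg_of_twistedHeatVarNonneg hTV) hB

/-! ## §7 The weakest time-side supplier: the QUADRATICALLY weighted negative kernel mass -/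

/-- **Band negative mass `𝔔_N(t) := ∫_{(0,∞)} min((r/t)²/2, 2)·K_N(r)⁻ dr`** (`x⁻ = max(−x,0)`): the negative part of the kernel weighed by the largest
value the dip weight `1 − cos ωr` takes on the band `ω ≤ 1/t` — QUADRATIC `(r/t)²/2` below the horizon `t`, capped at `2` beyond.  Compare NODE 109's
`lateNegMass` (`min(r,t)·K⁻`, LINEAR below the horizon). [formal bookkeeping; this cell] -/
def bandNegMass (ω₂ lam β γ T : ℝ) (N : ℕ) (t : ℝ) : ℝ :=
  ∫ r in Ioi (0 : ℝ), min ((r / t) ^ 2 / 2) 2 * max (-(bathKinCorr ω₂ lam β γ T N r)) 0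

/-- **(BNM) `BandNegMass`** — `∀ c > 0 ∃ C N₀ ∀ N ≥ N₀: (γ/T²)·𝔔_N(cN²) ≤ C/N`: the band-weighted negative kernel mass is `O(1/N)`.  The weakest ONE-SIDED
time-domain supplier of the band floor (`bandDeficitFloor_of_bandNegMass`, `θ ≤ 1`); implied by NODE 109's weakest one-sided supplier of the residual of
record for EVERY light-cone slope (`bandNegMass_of_lateNegMass : LateNegMass a ⟹ BandNegMass`, `a > 0`: early lags `r ≤ aN` are free by the quadratic
weight, `(aN/cN²)²·2T²·aN = O(1/N)`; late lags by `min((r/t)²/2,2) ≤ (2/t)min(r,t)`), NOT conversely (negative mass `m` at lag `r = N^{3/2}` may be `O(1)`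
here but only `O(N^{−1/2})` there).  UNDECIDED · WEAKER than `LateNegMass a` · phonon-TRUE (`K^{harm} ≥ 0`) · INSTRUMENTABLE. (piece · supplier)
[route statement · this cell] -/
def BandNegMass : Prop :=
  ∀ ω₂ lam β γ : ℝ, 0 < ω₂ → 0 < lam → 0 < β → 0 < γ → ∀ T : ℝ, 0 < T → ∀ c : ℝ, 0 < c →
    ∃ C : ℝ, ∃ N₀ : ℕ, ∀ N : ℕ, N₀ ≤ N → γ / T ^ 2 * bandNegMass ω₂ lam β γ T N (c * (N : ℝ) ^ 2) ≤ C / N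

/-- `1 − cos x ≤ min(x²/2, 2)`. [folklore] -/
theorem one_sub_cos_le_min_sq (x : ℝ) : 1 - Real.cos x ≤ min (x ^ 2 / 2) 2 := by
  refine le_min ?_ (one_sub_cos_mem_Icc x).2
  have := Real.one_sub_sq_div_two_le_cos (x := x)
  linarith

/-- The band weight is measurable. [formal bookkeeping] -/
theorem measurable_bandWeight (t : ℝ) : Measurable fun r : ℝ => min ((r / t) ^ 2 / 2) 2 :=
  (((measurable_id.div_const t).pow_const 2).div_const 2).min measurable_const

/-- `0 ≤ min((r/t)²/2, 2) ≤ 2`. [formal bookkeeping] -/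
theorem bandWeight_mem_Icc (r t : ℝ) : min ((r / t) ^ 2 / 2) 2 ∈ Icc (0 : ℝ) 2 :=
  ⟨le_min (by positivity) zero_le_two, min_le_right _ _⟩

/-- Below the horizon the band weight is quadratic and monotone: `0 ≤ r ≤ s` ⟹ `min((r/t)²/2,2) ≤ (s/t)²/2` (`t > 0`). [formal bookkeeping] -/
theorem bandWeight_le_sq {r s t : ℝ} (ht : 0 < t) (hr : 0 ≤ r) (hrs : r ≤ s) : min ((r / t) ^ 2 / 2) 2 ≤ (s / t) ^ 2 / 2 := by
  refine (min_le_left _ _).trans ?_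
  have h1 : r / t ≤ s / t := div_le_div_of_nonneg_right hrs ht.le
  have h0 : 0 ≤ r / t := div_nonneg hr ht.le
  nlinarith

/-- The band weight is dominated by NODE 109's linear weight: `min((r/t)²/2, 2) ≤ (2/t)·min(r,t)` for `r ≥ 0`, `t > 0`. [formal bookkeeping] -/
theorem bandWeight_le_linear {r t : ℝ} (ht : 0 < t) (hr : 0 ≤ r) : min ((r / t) ^ 2 / 2) 2 ≤ 2 / t * min r t := by
  rcases le_or_gt r t with hrt | hrt
  · rw [min_eq_left hrt]
    refine (min_le_left _ _).trans ?_
    have hx : r / t ≤ 1 := (div_le_one ht).2 hrt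
    have h0 : 0 ≤ r / t := div_nonneg hr ht.le
    calc (r / t) ^ 2 / 2 ≤ (r / t) * 2 := by nlinarith
      _ = 2 / t * r := by ring
  · rw [min_eq_right hrt.le]
    refine (min_le_right _ _).trans (le_of_eq ?_)
    field_simp

/-- `0 ≤ 𝔔_N(t)`. [formal bookkeeping] -/
theorem bandNegMass_nonneg (ω₂ lam β γ T : ℝ) (N : ℕ) (t : ℝ) : 0 ≤ bandNegMass ω₂ lam β γ T N t :=
  setIntegral_nonneg measurableSet_Ioi fun r _ => mul_nonneg (bandWeight_mem_Icc r t).1 (le_max_right _ _)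

section FixedNBand

variable {ω₂ lam β γ : ℝ} (hω : 0 < ω₂) (hl : 0 < lam) (hβ : 0 < β) (hγ : 0 < γ) {T : ℝ} (hT : 0 < T)
include hω hl hβ hγ hT

/-- `K_N⁻ = max(−K_N, 0)` is integrable on `(0,∞)` (every `N`). [formal bookkeeping] -/
theorem integrableOn_negPart_bathKinCorr (N : ℕ) :
    IntegrableOn (fun r : ℝ => max (-(bathKinCorr ω₂ lam β γ T N r)) 0) (Ioi 0) := by
  have hKm := (continuous_escapeKernel hω hl hβ hγ hT N).measurable
  have hKi := integrableOn_escapeKernel hω hl hβ hγ hT N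
  rw [bathKinCorr_eq_escapeKernel]
  refine Integrable.mono' hKi.norm (hKm.neg.max measurable_const).aestronglyMeasurable (ae_of_all _ fun r => ?_)
  rw [Real.norm_eq_abs, abs_of_nonneg (le_max_right _ _), Real.norm_eq_abs]
  exact max_le (neg_le_abs _) (abs_nonneg _)

/-- The band-weighted negative part is integrable on `(0,∞)` and on every measurable subset. [formal bookkeeping] -/
theorem integrableOn_bandWeight_mul_negPart (N : ℕ) (t : ℝ) :
    IntegrableOn (fun r : ℝ => min ((r / t) ^ 2 / 2) 2 * max (-(bathKinCorr ω₂ lam β γ T N r)) 0) (Ioi 0) := by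
  refine Integrable.bdd_mul (integrableOn_negPart_bathKinCorr hω hl hβ hγ hT N) (measurable_bandWeight t).aestronglyMeasurable (c := 2)
    (ae_of_all _ fun r => ?_)
  rw [Real.norm_eq_abs, abs_of_nonneg (bandWeight_mem_Icc r t).1]
  exact (bandWeight_mem_Icc r t).2

/-- ★ **On the band the dip is at least minus the band negative mass**: `0 ≤ ω`, `ωt ≤ 1`, `t > 0` ⟹ `M_N(ω) ≥ −(γ/T²)·𝔔_N(t)`
(`(1 − cos ωr)K ≥ −(1 − cos ωr)K⁻ ≥ −min((ωr)²/2,2)K⁻ ≥ −min((r/t)²/2,2)K⁻`). [this cell] -/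
theorem warburgDip_ge_neg_bandNegMass (N : ℕ) {t ω : ℝ} (ht : 0 < t) (hω0 : 0 ≤ ω) (hωt : ω * t ≤ 1) :
    -(γ / T ^ 2 * bandNegMass ω₂ lam β γ T N t) ≤ warburgDip ω₂ lam β γ T N ω := by
  have hKm := (continuous_escapeKernel hω hl hβ hγ hT N).measurable
  have hKi := integrableOn_escapeKernel hω hl hβ hγ hT N
  have hdipi : IntegrableOn (fun r : ℝ => (1 - Real.cos (ω * r)) * escapeKernel ω₂ lam β γ T N r) (Ioi 0) := by
    refine Integrable.bdd_mul hKi (c := 2) ?_ (ae_of_all _ fun r => ?_)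
    · exact (measurable_const.sub (Real.continuous_cos.measurable.comp (measurable_const.mul measurable_id))).aestronglyMeasurable
    · rw [Real.norm_eq_abs, abs_of_nonneg (one_sub_cos_mem_Icc _).1]; exact (one_sub_cos_mem_Icc _).2
  have hw : ∀ r : ℝ, 0 < r → 1 - Real.cos (ω * r) ≤ min ((r / t) ^ 2 / 2) 2 := by
    intro r hr
    refine (one_sub_cos_le_min_sq (ω * r)).trans (min_le_min ?_ le_rfl)
    have h1 : ω * r ≤ r / t := by
      rw [le_div_iff₀ ht]; nlinarith
    have h0 : 0 ≤ ω * r := mul_nonneg hω0 hr.le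
    have : (ω * r) ^ 2 ≤ (r / t) ^ 2 := pow_le_pow_left₀ h0 h1 2
    linarith
  have hpt : ∀ r ∈ Ioi (0 : ℝ), -(min ((r / t) ^ 2 / 2) 2 * max (-(bathKinCorr ω₂ lam β γ T N r)) 0) ≤
      (1 - Real.cos (ω * r)) * escapeKernel ω₂ lam β γ T N r := by
    intro r hr
    rw [bathKinCorr_eq_escapeKernel]
    set K := escapeKernel ω₂ lam β γ T N r
    have hc := one_sub_cos_mem_Icc (ω * r)
    rcases le_or_gt 0 K with hK | hK
    · rw [max_eq_right (by linarith)]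
      have : 0 ≤ (1 - Real.cos (ω * r)) * K := mul_nonneg hc.1 hK
      linarith
    · rw [max_eq_left (by linarith)]
      have h1 : (1 - Real.cos (ω * r)) * (-K) ≤ min ((r / t) ^ 2 / 2) 2 * (-K) :=
        mul_le_mul_of_nonneg_right (hw r hr) (by linarith)
      linarith
  have hmono := setIntegral_mono_on (integrableOn_bandWeight_mul_negPart hω hl hβ hγ hT N t).neg hdipi measurableSet_Ioi hpt
  simp only [Pi.neg_apply] at hmono
  rw [integral_neg] at hmono
  have hγT : 0 ≤ γ / T ^ 2 := by positivity
  have := mul_le_mul_of_nonneg_left hmono hγT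
  rw [warburgDip, bandNegMass]
  linarith

/-- ★ **`𝔔_N(t) ≤ T²s³/t² + (2/t)·𝔐_N(s,t)`** for `0 < s`, `0 < t`, `N ≥ 1`: early lags `r ≤ s` cost at most `(s/t)²/2 · 2T² · s` (`|K_N| ≤ 2T²`), late lags are
dominated by NODE 109's linear negative mass. [this cell] -/
theorem bandNegMass_le_lateNegMass {N : ℕ} (hN : 0 < N) {s t : ℝ} (hs : 0 < s) (ht : 0 < t) :
    bandNegMass ω₂ lam β γ T N t ≤ T ^ 2 * s ^ 3 / t ^ 2 + 2 / t * lateNegMass ω₂ lam β γ T N s t := by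
  have hKb := (bathKinCorr_basics hω hl hβ hγ hT hN).2.1
  have hwi := integrableOn_bandWeight_mul_negPart hω hl hβ hγ hT N t
  have hneg := integrableOn_negPart_bathKinCorr hω hl hβ hγ hT N
  have hnegb : ∀ r, max (-(bathKinCorr ω₂ lam β γ T N r)) 0 ≤ 2 * T ^ 2 := fun r =>
    max_le ((neg_le_abs _).trans (hKb r)) (by positivity)
  -- split (0,∞) = (0,s] ∪ (s,∞)
  have hsplit : bandNegMass ω₂ lam β γ T N t =
      (∫ r in Ioc 0 s, min ((r / t) ^ 2 / 2) 2 * max (-(bathKinCorr ω₂ lam β γ T N r)) 0) +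
        ∫ r in Ioi s, min ((r / t) ^ 2 / 2) 2 * max (-(bathKinCorr ω₂ lam β γ T N r)) 0 := by
    rw [bandNegMass, ← Ioc_union_Ioi_eq_Ioi hs.le, setIntegral_union Ioc_disjoint_Ioi_same measurableSet_Ioi
      (hwi.mono_set Ioc_subset_Ioi_self) (hwi.mono_set (Ioi_subset_Ioi hs.le))]
  -- early piece
  have hearly : ∫ r in Ioc 0 s, min ((r / t) ^ 2 / 2) 2 * max (-(bathKinCorr ω₂ lam β γ T N r)) 0 ≤ T ^ 2 * s ^ 3 / t ^ 2 := by
    have hb : ∀ r ∈ Ioc (0 : ℝ) s, min ((r / t) ^ 2 / 2) 2 * max (-(bathKinCorr ω₂ lam β γ T N r)) 0 ≤ (s / t) ^ 2 / 2 * (2 * T ^ 2) :=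
      fun r hr => mul_le_mul (bandWeight_le_sq ht hr.1.le hr.2) (hnegb r) (le_max_right _ _) (by positivity)
    have h1 := setIntegral_mono_on (hwi.mono_set Ioc_subset_Ioi_self) (integrableOn_const (hs := by simp [Real.volume_Ioc]))
      measurableSet_Ioc hb
    refine h1.trans (le_of_eq ?_)
    rw [setIntegral_const, Real.volume_real_Ioc_of_le hs.le, sub_zero, smul_eq_mul]
    field_simp
  -- late piece
  have hlate : ∫ r in Ioi s, min ((r / t) ^ 2 / 2) 2 * max (-(bathKinCorr ω₂ lam β γ T N r)) 0 ≤
      2 / t * lateNegMass ω₂ lam β γ T N s t := by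
    have hmi : IntegrableOn (fun r : ℝ => min r t * max (-(bathKinCorr ω₂ lam β γ T N r)) 0) (Ioi s) := by
      refine Integrable.bdd_mul (hneg.mono_set (Ioi_subset_Ioi hs.le)) (measurable_id.min measurable_const).aestronglyMeasurable
        (c := max s t) ((ae_restrict_mem measurableSet_Ioi).mono fun r hr => ?_)
      have hr : s < r := hr
      rw [Real.norm_eq_abs, abs_of_nonneg (le_min (by linarith) ht.le)]
      exact (min_le_right _ _).trans (le_max_right _ _)
    have hb : ∀ r ∈ Ioi s, min ((r / t) ^ 2 / 2) 2 * max (-(bathKinCorr ω₂ lam β γ T N r)) 0 ≤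
        2 / t * (min r t * max (-(bathKinCorr ω₂ lam β γ T N r)) 0) := by
      intro r hr
      have hr : s < r := hr
      rw [← mul_assoc]
      exact mul_le_mul_of_nonneg_right (bandWeight_le_linear ht (by linarith)) (le_max_right _ _)
    have h1 := setIntegral_mono_on (hwi.mono_set (Ioi_subset_Ioi hs.le)) (hmi.const_mul (2 / t)) measurableSet_Ioi hb
    rwa [integral_const_mul] at h1
  rw [hsplit]
  exact add_le_add hearly hlate

end FixedNBand

/-- ★ **(BNM) ⟹ (BDF_θ)** for `θ ≤ 1` (`η = C`): on the band `h_N = E_N + M_N ≥ E_N − (γ/T²)𝔔_N(cN²) ≥ θE_N − C/N`. [this cell] -/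
theorem bandDeficitFloor_of_bandNegMass {θ : ℝ} (hθ : θ ≤ 1) (hQ : BandNegMass) : BandDeficitFloor θ := by
  intro ω₂ lam β γ hω hl hβ hγ T hT c hc
  obtain ⟨C, N₀, hC⟩ := hQ ω₂ lam β γ hω hl hβ hγ T hT c hc
  refine ⟨C, max N₀ 2, fun N hN ω hω0 hωt => ?_⟩
  have hNN₀ : N₀ ≤ N := le_trans (le_max_left _ _) hN
  have hN2 : 2 ≤ N := le_trans (le_max_right _ _) hN
  have hNpos : (0 : ℝ) < N := by exact_mod_cast lt_of_lt_of_le (Nat.succ_pos 1) hN2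
  have ht : 0 < c * (N : ℝ) ^ 2 := by positivity
  have hM := warburgDip_ge_neg_bandNegMass hω hl hβ hγ hT N ht hω0.le hωt
  have hE := escapeDeficit_nonneg' hω hl hβ hγ hT hN2
  have h1 := hC N hNN₀
  rw [spectralDeficit_eq_escapeDeficit_add_warburgDip hω hl hβ hγ hT N ω]
  have hθE : θ * escapeDeficit ω₂ lam β γ T N ≤ escapeDeficit ω₂ lam β γ T N := by nlinarith
  linarith

/-- ★ **`LateNegMass a ⟹ (BNM)`** for every light-cone slope `a > 0`: with `s = aN`, `t = cN²`,
`(γ/T²)𝔔_N ≤ γa³/(c²N) + (2/(cT²N²))·γ𝔐_N(aN,cN²) ≤ (γa³/c² + 2C⁺/(cγT²))/N`.  NODE 109's weakest one-sided supplier of the residual of record feeds the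
band floor; the converse is not claimed (the quadratic weight is blind to `O(1)` negative mass at lags `N ≪ r ≪ N²`). [this cell] -/
theorem bandNegMass_of_lateNegMass {a : ℝ} (ha : 0 < a) (hM : LateNegMass a) : BandNegMass := by
  intro ω₂ lam β γ hω hl hβ hγ T hT c hc
  obtain ⟨C, N₀, hC⟩ := hM ω₂ lam β γ hω hl hβ hγ T hT c hc
  refine ⟨γ * a ^ 3 / c ^ 2 + 2 * max C 0 / (c * γ * T ^ 2), max N₀ 1, fun N hN => ?_⟩
  have hNN₀ : N₀ ≤ N := le_trans (le_max_left _ _) hN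
  have hN1 : 0 < N := lt_of_lt_of_le Nat.one_pos (le_trans (le_max_right _ _) hN)
  have hNpos : (0 : ℝ) < N := by exact_mod_cast hN1
  have hs : 0 < a * (N : ℝ) := by positivity
  have ht : 0 < c * (N : ℝ) ^ 2 := by positivity
  have h1 := bandNegMass_le_lateNegMass hω hl hβ hγ hT hN1 hs ht
  have h2 := hC N hNN₀
  have hMnn : 0 ≤ lateNegMass ω₂ lam β γ T N (a * N) (c * (N : ℝ) ^ 2) :=
    setIntegral_nonneg measurableSet_Ioi fun r hr => mul_nonneg (le_min (by linarith [show a * N < r from hr]) ht.le) (le_max_right _ _)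
  have hγT : 0 < γ / T ^ 2 := by positivity
  -- (γ/T²)·(T² s³/t²) = γ a³/(c² N) and (γ/T²)(2/t)𝔐 ≤ 2C⁺/(cγT² N)
  have e1 : γ / T ^ 2 * (T ^ 2 * (a * (N : ℝ)) ^ 3 / (c * (N : ℝ) ^ 2) ^ 2) = γ * a ^ 3 / c ^ 2 / N := by
    field_simp
  have e2 : γ / T ^ 2 * (2 / (c * (N : ℝ) ^ 2) * lateNegMass ω₂ lam β γ T N (a * N) (c * (N : ℝ) ^ 2)) =
      2 / (c * γ * T ^ 2) / N * (γ ^ 2 * lateNegMass ω₂ lam β γ T N (a * N) (c * (N : ℝ) ^ 2)) / N := by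
    field_simp
  have h3 : γ ^ 2 * lateNegMass ω₂ lam β γ T N (a * N) (c * (N : ℝ) ^ 2) / N ≤ max C 0 := by
    rw [div_le_iff₀ hNpos]; exact h2.trans (mul_le_mul_of_nonneg_right (le_max_left _ _) hNpos.le)
  calc γ / T ^ 2 * bandNegMass ω₂ lam β γ T N (c * (N : ℝ) ^ 2)
      ≤ γ / T ^ 2 * (T ^ 2 * (a * (N : ℝ)) ^ 3 / (c * (N : ℝ) ^ 2) ^ 2 + 2 / (c * (N : ℝ) ^ 2) * lateNegMass ω₂ lam β γ T N (a * N) (c * (N : ℝ) ^ 2)) :=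
        mul_le_mul_of_nonneg_left h1 hγT.le
    _ = γ * a ^ 3 / c ^ 2 / N + 2 / (c * γ * T ^ 2) / N * (γ ^ 2 * lateNegMass ω₂ lam β γ T N (a * N) (c * (N : ℝ) ^ 2) / N) := by
        rw [mul_add, e1, e2]
        ring
    _ ≤ γ * a ^ 3 / c ^ 2 / N + 2 / (c * γ * T ^ 2) / N * max C 0 := by
        have h4 : 2 / (c * γ * T ^ 2) / N * (γ ^ 2 * lateNegMass ω₂ lam β γ T N (a * N) (c * (N : ℝ) ^ 2) / N) ≤
            2 / (c * γ * T ^ 2) / N * max C 0 := mul_le_mul_of_nonneg_left h3 (by positivity)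
        linarith
    _ = (γ * a ^ 3 / c ^ 2 + 2 * max C 0 / (c * γ * T ^ 2)) / N := by
        field_simp

/-- **`LateNegMass a ⟹ (BDF_θ)`** (`a > 0`, `θ ≤ 1`); hence every kernel / cumulant / forecast floor of NODEs 107–110 feeds the band door. [this cell] -/
theorem bandDeficitFloor_of_lateNegMass {a θ : ℝ} (ha : 0 < a) (hθ : θ ≤ 1) (hM : LateNegMass a) : BandDeficitFloor θ :=
  bandDeficitFloor_of_bandNegMass hθ (bandNegMass_of_lateNegMass ha hM)

/-- **Beneath (S): (S) ∧ (FC) ∧ (BNM) ⟹ 11071** — the band door with its weakest one-sided time-domain supplier. [this cell] -/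
theorem boundedResponse_of_subdiffusiveBondHeat_bandNegMass (hS : SubdiffusiveBondHeat) (hFC : SpectralDeficitNonneg) (hQ : BandNegMass) :
    BoundedResponse :=
  boundedResponse_of_subdiffusiveBondHeat_bandDeficitFloor one_pos hS hFC (bandDeficitFloor_of_bandNegMass le_rfl hQ)

end Summit.AtomisticToContinuum.FouriersLaw.Theorems.BoundedResponse.HeatSpreading

end
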